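import Summits.QuantumFields.YangMills.Theorems.BalabanUVNodesN15PerCubeGreenAdjointKnitLoc
import HarnessLib

/-!
# N15 = NE2, road (c) — PROGRAMME (PC), (PC-E-K) ENTRY 2 «`G′(U)∇*_U` of [B9] (3.42) for the NAMED scalar covariant Green's function, TWO GRIDS»: THE COARSE ONE-GRID SITE KIT OF THE
# ADJOINT KNIT, PACKAGED — n15-c∕283′'s forty-four site discharges of n15-c∕281′'s geometric hypotheses on the (PC) site carrier `ScX`, as ONE conjunction (dag-n15-c g37, n15-c∕429c)

Cell `pub-ymgap`, seat `pub-ymgap-dag-n15-c` (generation g37; R134 (a), s1; HUMAN RULING D-0062).  `bears_on: R4∕N15 · K3⁸ SpineGivenEndpointR13SepCoPHV (stmt-QuantumFields-27366)`;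
filed `--kind proof --supports stmt-QuantumFields-27366 --as helper` — COUNT-NEUTRAL.  One theorem; 0 `def`, 0 `sorry`.  Imports BY NAME n15-c∕283′ `…PerCubeGreenAdjointKnitLoc` (for
its imports: n15-c∕282a∕282b's site kit `hasMaj_cut∕cutF∕cutB_scCubeP`, `scCubeP_fgrad∕bgrad_sandwich`, `hasMaj_scT`, `scCubeP_flat_rightLocality`, `hasMaj_mulVecLin_comp_fgrad∕bgrad`,
n15-c∕261's `scXi_shift_lift`, `scChi_lift_eq_one_of_near_bbox`, `mulOp_scH_comp_mulOp_scPsi`, `hasMaj_commOp_scQQ`, the cover's window ∕ layer ∕ bump ∕ partition lemmas).  Nothing in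
the tree is modified; nothing restated: the conjuncts below are n15-c∕427's COARSE binders `hSχ … hKN` LITERALLY, instantiated at the site objects exactly as n15-c∕283′ instantiates
n15-c∕281′ (`N_k := M_{ψ_k}∘scCube`, `T^±_k := M_{ψ_k}∘(G′(1)∘∇^±_μ)∘M_{ψ_k}`, `N_L := scQQ`, letters `c_t = c₀ = c₁ = π∕L^m`, `c₂ = 32π²∕L^{2m}`, `ω = π(d+1)∕L^m`, `c_N = 2π(d+1)a₀∕L^m`,
`β = β₁ = C`, `β_Q = Ce^{δ}c_r + C`, rate `δ − δ∕32`, `ρ_N = δ∕2`), and the proof is n15-c∕283′'s discharge text verbatim.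

WHY.  n15-c∕427 (`uN_hasMaj_idef_rightInverse_comp_localGauges_cov_tr`, ✓) displays n15-c∕281′'s one-grid hypotheses at BOTH grids (≈ 2 × 57 binders) plus the two-grid rows; its site knit
(n15-c∕429) cannot repeat n15-c∕283′'s 250-line discharge twice inside one ≤ 400-line file.  THIS FILE packages the coarse-grid discharges once (`obtain ⟨hSχ, …, hKN⟩ := sc_adjointSiteKit …`
in the knit); its fine twin (n15-c∕429f, `ScX′`, generated from this file by the object substitution of n15-c∕428b∕428c) packages the fine ones; the knit then only produces the gauge data,
the two-grid rows (n15-c∕428a + dag-n15-a Ξ-4∕Ξ-7) and the letters.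

WHAT.  ★★ `sc_adjointSiteKit`: for `L ≥ 7` odd, `k ≥ 1`, `L^m ≥ 4`, the flat rows of `G′(1)` at King's mass (hypotheses, Ξ-4's shape) ⟹ the 44 facts [hSχ] [hSψ] [hχt] [hχ1] [hdχt] [hdχtb]
[hsub] [hχ] [hs] [hsb] [hdd] [hddb] [hNψ] [hψχ] [hcut] [hcutF] [hcutB] [hTf] [hTb] [hTfr] [hTbr] [hTfψ] [hTbψ] [hflat0] [hhabs] [h236] [hhcut] [hh1] [hh1b] [hh0] [hrh] [hh2] [hh2f] [hh2b]
[hlayf] [hlayb] [hlayν] [hhψ] [hχth] [hhts'] [hhtsb'] [hhtdd'] [hhtddb'] [hKN] of n15-c∕427's coarse block, in this order.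

HONEST FRAMING ∕ LIMITS.  Bookkeeping on the MODEL site carrier (doubled torus of the cover, one scale); the flat rows are HYPOTHESES (dag-n15-a Ξ-4 supplies them); nothing of
[B5]∕[B6]∕[B9] asserted ((3.42) p.397 at `U ≡ 1`, (3.62)–(3.65) pp.402–403, (3.87) p.409, [B6-II] (2.36)–(2.37) p.229, (2.133) p.247 = SHAPES).  NE2⁺ NOT PRINTED, NOT proved; N15 of
record untouched (DISCHARGED AS CONSUMED, p687738); K3⁸ OPEN; counts of record UNMOVED (typed 28∕28 · discharged 8∕27); one finite 𝕋⁴ at fixed ε per index — NOT infinite volume, NOT OS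
on ℝ⁴, NOT a mass gap, NOT Clay.  Restate-immune (no Theses import).
-/

noncomputable section

open scoped BigOperators Matrix Matrix.Norms.Frobenius

namespace Summit.QuantumFields.YangMills.BalabanUVNodes.N15.Gluing

open Real
open Literature.MathematicalPhysics.QuantumFieldTheory.Balaban1983to89
open Literature.MathematicalPhysics.QuantumFieldTheory.Balaban1983to89.B5Prop11Plancherel (Tor fine unitVec)
open Literature.MathematicalPhysics.QuantumFieldTheory.Balaban1983to89.B11SectG (BlockNorm HasMaj RowSum hasMaj_zero)
open Literature.MathematicalPhysics.QuantumFieldTheory.Balaban1983to89.B6RandomWalk (Triangle254)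
open Literature.MathematicalPhysics.QuantumFieldTheory.Balaban1983to89.B6Prop26Gluing (mulOp mulOp_apply ind ind_nonneg ind_le_one)
open Literature.MathematicalPhysics.QuantumFieldTheory.Balaban1983to89.B6UnitTorusCarrier (unitTorusGeo triangle254_unitTorusGeo rowSum_unitTorusGeo unitTorusGeo_dist unitTorusGeo_dist_nonneg
  unitTorusGeo_dist_symm unitTorusGeo_dist_self)
open Literature.MathematicalPhysics.QuantumFieldTheory.Balaban1983to89.B5SiteBridgeP12 (MP)
open Literature.MathematicalPhysics.QuantumFieldTheory.King1986 (aK aK_pos aK_le)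
open Literature.MathematicalPhysics.QuantumFieldTheory.King1986.Torus (blockOf tdistT tdistT_nonneg tdistT_symm)
open Literature.Barriers.QuantumFields (traceForm)
open Summit.QuantumFields.YangMills.BalabanUVNodes.N15.BackgroundLayer (fgrad fgradAdj bgrad fgrad_apply fgradAdj_apply bgrad_apply stack projO bgPropV covLapM tCoefA tCoefC unstackM fgradMat)
open Summit.QuantumFields.YangMills.BalabanUVNodes.N15.VectorPiece (bshiftEquiv bshiftEquiv_apply tensorId tdistT_blockOf_sub_unitVec_le)
open Summit.QuantumFields.YangMills.BalabanUVNodes.N15.MatrixSpecies (mmulOp coordMat liftBlk liftEquiv liftEquiv_apply liftEquiv_symm_apply)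
open Summit.QuantumFields.YangMills.BalabanUVNodes.N15.TwoGrid (paramsOf chiCube cubeBlocks chiCube_of_not_mem abs_chiCube_le_one)
open Summit.QuantumFields.YangMills.BalabanUVNodes.N15.CurvedSpecies (gaugePair uN_hasMaj_rightInverse_comp_localGauges_cov_loc)
open Summit.QuantumFields.YangMills.BalabanUVNodes.N15.CovLandau (cgrad csavg cGreen bBack flatRowsAll_king)

variable {d : ℕ}

/-! ## The coarse one-grid site kit of the adjoint knit -/

section Kit

variable {L : ℕ} [NeZero L]

set_option maxHeartbeats 1600000 in
/-- ★★ **THE COARSE ONE-GRID SITE KIT OF THE ADJOINT KNIT** (n15-c∕283′'s site discharges of n15-c∕281′'s geometric hypotheses, packaged): the supports, cuts, bumps, plateaus, margins,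
sandwiched right entries with their two-sided rows, the exact flat right locality, the partition's quotient letters and layers, and the flat nonlocal commutator row — n15-c∕427's
COARSE binders `hSχ … hKN` at the (PC) site objects, from the flat rows of `G′(1)` (hypotheses).  MODEL carriers; SHAPES of the cited displays, NOT the printed statements.
[cite: Balaban1985BackgroundPropagators, (3.62)–(3.65) pp.402–403, (3.87)–(3.88) p.409, Thm 3.1 (3.42) p.397 (entry `G′∇*` at `U ≡ 1`: shape); Balaban1984PropagatorsII, (2.36)–(2.37) p.229, (2.91) p.239, (2.133) p.247; King1986, Thm 3.3 (3.8) p.656] -/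
theorem sc_adjointSiteKit (hL : Odd L ∧ 1 < L) (hL7 : 7 ≤ L) {a₀ : ℝ} (ha₀ : 0 < a₀) (ι : Type) [Fintype ι] [DecidableEq ι] (mv kk : ℕ) (hk : 1 ≤ kk) (hW4R : (4 : ℝ) ≤ ((L ^ mv : ℕ) : ℝ))
      {C δm : ℝ} (hC : 0 < C) (hδm0 : 0 < δm) (ν : Fin (d + 1))
      -- the flat rows of `G′(1)` at the mass `a_K(a₀, L, k)·(L^k)^{d+1}` (dag-n15-a Ξ-4 `flatRowsAll_king`, rows 1–4 at `n = 1`)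
      (hG0 : HasMaj (ScNorm d L mv kk hL ι) (ScNorm d L mv kk hL ι) (Matrix.mulVecLin (cGreen (cvM d L mv kk hL) (L ^ kk) (fun (_ : Fin (d + 1)) (_ : ScX d L mv kk hL) => (1 : Matrix ι ι ℝ)) (aK a₀ (L : ℝ) kk * (((L ^ kk : ℕ) : ℝ)) ^ (d + 1)))) (fun y y' => C * Real.exp (-(δm * tdistT (cvM d L mv
          kk hL) y y'))))
      (hGF : HasMaj (ScNorm d L mv kk hL ι) (BlockNorm.ofBlocks (unitTorusGeo L kk (cvM d L mv kk hL)) (liftBlk (fun b : ScX d L mv kk hL × Fin (d + 1) => blockOf (L ^ kk) (cvM d L mv kk hL) b.1) ι))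
        (Matrix.mulVecLin (cgrad (cvM d L mv kk hL) (L ^ kk) (fun (_ : Fin (d + 1)) (_ : ScX d L mv kk hL) => (1 : Matrix ι ι ℝ)) * cGreen (cvM d L mv kk hL) (L ^ kk) (fun (_ : Fin (d + 1)) (_ : ScX d L mv kk hL) => (1 : Matrix ι ι ℝ)) (aK a₀ (L : ℝ) kk * (((L ^ kk : ℕ) : ℝ)) ^ (d + 1)))) (fun y y'
          => C * Real.exp (-(δm * tdistT (cvM d L mv kk hL) y y'))))
      (hGA : HasMaj (BlockNorm.ofBlocks (unitTorusGeo L kk (cvM d L mv kk hL)) (liftBlk (fun b : ScX d L mv kk hL × Fin (d + 1) => blockOf (L ^ kk) (cvM d L mv kk hL) b.1) ι)) (ScNorm d L mv kk hL ι)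
        (Matrix.mulVecLin (cGreen (cvM d L mv kk hL) (L ^ kk) (fun (_ : Fin (d + 1)) (_ : ScX d L mv kk hL) => (1 : Matrix ι ι ℝ)) (aK a₀ (L : ℝ) kk * (((L ^ kk : ℕ) : ℝ)) ^ (d + 1)) * (cgrad (cvM d L mv kk hL) (L ^ kk) (fun (_ : Fin (d + 1)) (_ : ScX d L mv kk hL) => (1 : Matrix ι ι ℝ)))ᵀ)) (fun y
          y' => C * Real.exp (-(δm * tdistT (cvM d L mv kk hL) y y'))))
      (hGB : HasMaj (ScNorm d L mv kk hL ι) (BlockNorm.ofBlocks (unitTorusGeo L kk (cvM d L mv kk hL)) (liftBlk (fun b : ScX d L mv kk hL × Fin (d + 1) => blockOf (L ^ kk) (cvM d L mv kk hL) b.1) ι))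
        (Matrix.mulVecLin (bBack (cvM d L mv kk hL) (L ^ kk) (ι := ι) * (cgrad (cvM d L mv kk hL) (L ^ kk) (fun (_ : Fin (d + 1)) (_ : ScX d L mv kk hL) => (1 : Matrix ι ι ℝ)) * cGreen (cvM d L mv kk hL) (L ^ kk) (fun (_ : Fin (d + 1)) (_ : ScX d L mv kk hL) => (1 : Matrix ι ι ℝ)) (aK a₀ (L : ℝ) kk
          * (((L ^ kk : ℕ) : ℝ)) ^ (d + 1))))) (fun y y' => C * Real.exp (-(δm * tdistT (cvM d L mv kk hL) y y')))) :
      -- [hSχ], [hSψ], [hχt], [hχ1], [hdχt], [hdχtb], [hsub], [hχ], [hs], [hsb], [hdd], [hddb], [hNψ], [hψχ], [hcut], [hcutF], [hcutB], [hTf], [hTb], [hTfr], [hTbr], [hTfψ]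
      -- [hTbψ], [hflat0], [hhabs], [h236], [hhcut], [hh1], [hh1b], [hh0], [hrh], [hh2], [hh2f], [hh2b], [hlayf], [hlayb], [hlayν], [hhψ], [hχth], [hhts'], [hhtsb'], [hhtdd'], [hhtddb'], [hKN]
      (∀ k x, scChi d L mv kk hL k x ≠ 0 → scBlk d L mv kk hL x ∈ cvSk d L mv kk hL k) ∧
      (∀ k x, scPsi d L mv kk hL k x ≠ 0 → scBlk d L mv kk hL x ∈ cvSk d L mv kk hL k) ∧
      (∀ k x, |scBump d L mv kk hL k x| ≤ 1) ∧
      (∀ k x, |scChi d L mv kk hL k x| ≤ 1) ∧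
      (∀ k μ p, |fgrad ((((L ^ kk : ℕ) : ℝ))⁻¹)⁻¹ (liftEquiv (scShift d L mv kk hL μ) ι) (fun p : ScX d L mv kk hL × ι => scBump d L mv kk hL k p.1) p| ≤ (π / ((L ^ mv : ℕ) : ℝ))) ∧
      (∀ k μ p, |bgrad ((((L ^ kk : ℕ) : ℝ))⁻¹)⁻¹ (liftEquiv (scShift d L mv kk hL μ) ι) (fun p : ScX d L mv kk hL × ι => scBump d L mv kk hL k p.1) p| ≤ (π / ((L ^ mv : ℕ) : ℝ))) ∧
      (∀ k, mulOp (fun p : ScX d L mv kk hL × ι => scBump d L mv kk hL k p.1) ∘ₗ mulOp (fun p : ScX d L mv kk hL × ι => scChi d L mv kk hL k p.1) = mulOp (fun p : ScX d L mv kk hL × ι => scBump d L mv kk hL k p.1)) ∧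
      (∀ k, mulOp (fun p : ScX d L mv kk hL × ι => scChi d L mv kk hL k p.1) ∘ₗ mulOp (fun p : ScX d L mv kk hL × ι => scBump d L mv kk hL k p.1) = mulOp (fun p : ScX d L mv kk hL × ι => scBump d L mv kk hL k p.1)) ∧
      (∀ k μ, mulOp ((fun p : ScX d L mv kk hL × ι => scBump d L mv kk hL k p.1) ∘ (liftEquiv (scShift d L mv kk hL μ) ι)) ∘ₗ mulOp (fun p : ScX d L mv kk hL × ι => scChi d L mv kk hL k p.1) = mulOp ((fun p : ScX d L mv kk hL × ι => scBump d L mv kk hL k p.1) ∘ (liftEquiv (scShift d L mv kk hL μ)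
          ι))) ∧
      (∀ k μ, mulOp ((fun p : ScX d L mv kk hL × ι => scBump d L mv kk hL k p.1) ∘ (liftEquiv (scShift d L mv kk hL μ) ι).symm) ∘ₗ mulOp (fun p : ScX d L mv kk hL × ι => scChi d L mv kk hL k p.1) = mulOp ((fun p : ScX d L mv kk hL × ι => scBump d L mv kk hL k p.1) ∘ (liftEquiv (scShift d L mv kk hL
          μ) ι).symm)) ∧
      (∀ k μ, mulOp (fgrad ((((L ^ kk : ℕ) : ℝ))⁻¹)⁻¹ (liftEquiv (scShift d L mv kk hL μ) ι) (fun p : ScX d L mv kk hL × ι => scBump d L mv kk hL k p.1)) ∘ₗ mulOp (fun p : ScX d L mv kk hL × ι => scChi d L mv kk hL k p.1) = mulOp (fgrad ((((L ^ kk : ℕ) : ℝ))⁻¹)⁻¹ (liftEquiv (scShift d L mv kk hL μ)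
          ι) (fun p : ScX d L mv kk hL × ι => scBump d L mv kk hL k p.1))) ∧
      (∀ k μ, mulOp (bgrad ((((L ^ kk : ℕ) : ℝ))⁻¹)⁻¹ (liftEquiv (scShift d L mv kk hL μ) ι) (fun p : ScX d L mv kk hL × ι => scBump d L mv kk hL k p.1)) ∘ₗ mulOp (fun p : ScX d L mv kk hL × ι => scChi d L mv kk hL k p.1) = mulOp (bgrad ((((L ^ kk : ℕ) : ℝ))⁻¹)⁻¹ (liftEquiv (scShift d L mv kk hL μ)
          ι) (fun p : ScX d L mv kk hL × ι => scBump d L mv kk hL k p.1))) ∧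
      (∀ k, (mulOp (fun p : ScX d L mv kk hL × ι => scPsi d L mv kk hL k p.1) ∘ₗ scCube d L mv kk hL (aK a₀ (L : ℝ) kk * (((L ^ kk : ℕ) : ℝ)) ^ (d + 1)) ι k) ∘ₗ mulOp (fun p : ScX d L mv kk hL × ι => scPsi d L mv kk hL k p.1) = (mulOp (fun p : ScX d L mv kk hL × ι => scPsi d L mv kk hL k p.1) ∘ₗ
          scCube d L mv kk hL (aK a₀ (L : ℝ) kk * (((L ^ kk : ℕ) : ℝ)) ^ (d + 1)) ι k)) ∧
      (∀ k, mulOp (fun p : ScX d L mv kk hL × ι => scPsi d L mv kk hL k p.1) ∘ₗ mulOp (fun p : ScX d L mv kk hL × ι => scChi d L mv kk hL k p.1) = mulOp (fun p : ScX d L mv kk hL × ι => scChi d L mv kk hL k p.1)) ∧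
      (∀ k, HasMaj (ScNorm d L mv kk hL ι) (ScNorm d L mv kk hL ι) (mulOp (fun p : ScX d L mv kk hL × ι => scChi d L mv kk hL k p.1) ∘ₗ (mulOp (fun p : ScX d L mv kk hL × ι => scPsi d L mv kk hL k p.1) ∘ₗ scCube d L mv kk hL (aK a₀ (L : ℝ) kk * (((L ^ kk : ℕ) : ℝ)) ^ (d + 1)) ι k)) (fun y y' => ind
          (cvSk d L mv kk hL k) y * ind (cvSk d L mv kk hL k) y' * (C * Real.exp (-((δm - δm / 32) * (unitTorusGeo L kk (cvM d L mv kk hL)).dist y y'))))) ∧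
      (∀ k μ, HasMaj (ScNorm d L mv kk hL ι) (ScNorm d L mv kk hL ι) (mulOp (fun p : ScX d L mv kk hL × ι => scChi d L mv kk hL k p.1) ∘ₗ (fgrad ((((L ^ kk : ℕ) : ℝ))⁻¹)⁻¹ (liftEquiv (scShift d L mv kk hL μ) ι) ∘ₗ (mulOp (fun p : ScX d L mv kk hL × ι => scPsi d L mv kk hL k p.1) ∘ₗ scCube d L mv kk
          hL (aK a₀ (L : ℝ) kk * (((L ^ kk : ℕ) : ℝ)) ^ (d + 1)) ι k))) (fun y y' => ind (cvSk d L mv kk hL k) y * ind (cvSk d L mv kk hL k) y' * (C * Real.exp (-((δm - δm / 32) * (unitTorusGeo L kk (cvM d L mv kk hL)).dist y y'))))) ∧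
      (∀ k μ, HasMaj (ScNorm d L mv kk hL ι) (ScNorm d L mv kk hL ι) (mulOp (fun p : ScX d L mv kk hL × ι => scChi d L mv kk hL k p.1) ∘ₗ (bgrad ((((L ^ kk : ℕ) : ℝ))⁻¹)⁻¹ (liftEquiv (scShift d L mv kk hL μ) ι) ∘ₗ (mulOp (fun p : ScX d L mv kk hL × ι => scPsi d L mv kk hL k p.1) ∘ₗ scCube d L mv kk
          hL (aK a₀ (L : ℝ) kk * (((L ^ kk : ℕ) : ℝ)) ^ (d + 1)) ι k))) (fun y y' => ind (cvSk d L mv kk hL k) y * ind (cvSk d L mv kk hL k) y' * (C * Real.exp (-((δm - δm / 32) * (unitTorusGeo L kk (cvM d L mv kk hL)).dist y y'))))) ∧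
      (∀ k μ, (mulOp (fun p : ScX d L mv kk hL × ι => scPsi d L mv kk hL k p.1) ∘ₗ scCube d L mv kk hL (aK a₀ (L : ℝ) kk * (((L ^ kk : ℕ) : ℝ)) ^ (d + 1)) ι k) ∘ₗ fgrad ((((L ^ kk : ℕ) : ℝ))⁻¹)⁻¹ (liftEquiv (scShift d L mv kk hL μ) ι) ∘ₗ mulOp (fun p : ScX d L mv kk hL × ι => scChi d L mv kk hL k
          p.1) = (mulOp (fun p : ScX d L mv kk hL × ι => scPsi d L mv kk hL k p.1) ∘ₗ ((Matrix.mulVecLin (cGreen (cvM d L mv kk hL) (L ^ kk) (fun (_ : Fin (d + 1)) (_ : ScX d L mv kk hL) => (1 : Matrix ι ι ℝ)) (aK a₀ (L : ℝ) kk * (((L ^ kk : ℕ) : ℝ)) ^ (d + 1)))) ∘ₗ fgrad ((((L ^ kk : ℕ) : ℝ))⁻¹)⁻¹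
          (liftEquiv (scShift d L mv kk hL μ) ι)) ∘ₗ mulOp (fun p : ScX d L mv kk hL × ι => scPsi d L mv kk hL k p.1)) ∘ₗ mulOp (fun p : ScX d L mv kk hL × ι => scChi d L mv kk hL k p.1)) ∧
      (∀ k μ, (mulOp (fun p : ScX d L mv kk hL × ι => scPsi d L mv kk hL k p.1) ∘ₗ scCube d L mv kk hL (aK a₀ (L : ℝ) kk * (((L ^ kk : ℕ) : ℝ)) ^ (d + 1)) ι k) ∘ₗ bgrad ((((L ^ kk : ℕ) : ℝ))⁻¹)⁻¹ (liftEquiv (scShift d L mv kk hL μ) ι) ∘ₗ mulOp (fun p : ScX d L mv kk hL × ι => scChi d L mv kk hL k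
          p.1) = (mulOp (fun p : ScX d L mv kk hL × ι => scPsi d L mv kk hL k p.1) ∘ₗ ((Matrix.mulVecLin (cGreen (cvM d L mv kk hL) (L ^ kk) (fun (_ : Fin (d + 1)) (_ : ScX d L mv kk hL) => (1 : Matrix ι ι ℝ)) (aK a₀ (L : ℝ) kk * (((L ^ kk : ℕ) : ℝ)) ^ (d + 1)))) ∘ₗ bgrad ((((L ^ kk : ℕ) : ℝ))⁻¹)⁻¹
          (liftEquiv (scShift d L mv kk hL μ) ι)) ∘ₗ mulOp (fun p : ScX d L mv kk hL × ι => scPsi d L mv kk hL k p.1)) ∘ₗ mulOp (fun p : ScX d L mv kk hL × ι => scChi d L mv kk hL k p.1)) ∧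
      (∀ k μ, HasMaj (ScNorm d L mv kk hL ι) (ScNorm d L mv kk hL ι) ((mulOp (fun p : ScX d L mv kk hL × ι => scPsi d L mv kk hL k p.1) ∘ₗ ((Matrix.mulVecLin (cGreen (cvM d L mv kk hL) (L ^ kk) (fun (_ : Fin (d + 1)) (_ : ScX d L mv kk hL) => (1 : Matrix ι ι ℝ)) (aK a₀ (L : ℝ) kk * (((L ^ kk : ℕ) :
          ℝ)) ^ (d + 1)))) ∘ₗ fgrad ((((L ^ kk : ℕ) : ℝ))⁻¹)⁻¹ (liftEquiv (scShift d L mv kk hL μ) ι)) ∘ₗ mulOp (fun p : ScX d L mv kk hL × ι => scPsi d L mv kk hL k p.1))) (fun y y' => ind (cvSk d L mv kk hL k) y * ind (cvSk d L mv kk hL k) y' * ((C * Real.exp δm * B4Sect5Proof.latticeConst (d +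
          1) (δm / 32) + C) * Real.exp (-((δm - δm / 32) * (unitTorusGeo L kk (cvM d L mv kk hL)).dist y y'))))) ∧
      (∀ k μ, HasMaj (ScNorm d L mv kk hL ι) (ScNorm d L mv kk hL ι) ((mulOp (fun p : ScX d L mv kk hL × ι => scPsi d L mv kk hL k p.1) ∘ₗ ((Matrix.mulVecLin (cGreen (cvM d L mv kk hL) (L ^ kk) (fun (_ : Fin (d + 1)) (_ : ScX d L mv kk hL) => (1 : Matrix ι ι ℝ)) (aK a₀ (L : ℝ) kk * (((L ^ kk : ℕ) :
          ℝ)) ^ (d + 1)))) ∘ₗ bgrad ((((L ^ kk : ℕ) : ℝ))⁻¹)⁻¹ (liftEquiv (scShift d L mv kk hL μ) ι)) ∘ₗ mulOp (fun p : ScX d L mv kk hL × ι => scPsi d L mv kk hL k p.1))) (fun y y' => ind (cvSk d L mv kk hL k) y * ind (cvSk d L mv kk hL k) y' * ((C * Real.exp δm * B4Sect5Proof.latticeConst (d +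
          1) (δm / 32) + C) * Real.exp (-((δm - δm / 32) * (unitTorusGeo L kk (cvM d L mv kk hL)).dist y y'))))) ∧
      (∀ k μ, (mulOp (fun p : ScX d L mv kk hL × ι => scPsi d L mv kk hL k p.1) ∘ₗ ((Matrix.mulVecLin (cGreen (cvM d L mv kk hL) (L ^ kk) (fun (_ : Fin (d + 1)) (_ : ScX d L mv kk hL) => (1 : Matrix ι ι ℝ)) (aK a₀ (L : ℝ) kk * (((L ^ kk : ℕ) : ℝ)) ^ (d + 1)))) ∘ₗ fgrad ((((L ^ kk : ℕ) : ℝ))⁻¹)⁻¹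
          (liftEquiv (scShift d L mv kk hL μ) ι)) ∘ₗ mulOp (fun p : ScX d L mv kk hL × ι => scPsi d L mv kk hL k p.1)) ∘ₗ mulOp (fun p : ScX d L mv kk hL × ι => scPsi d L mv kk hL k p.1) = (mulOp (fun p : ScX d L mv kk hL × ι => scPsi d L mv kk hL k p.1) ∘ₗ ((Matrix.mulVecLin (cGreen (cvM d L mv kk
          hL) (L ^ kk) (fun (_ : Fin (d + 1)) (_ : ScX d L mv kk hL) => (1 : Matrix ι ι ℝ)) (aK a₀ (L : ℝ) kk * (((L ^ kk : ℕ) : ℝ)) ^ (d + 1)))) ∘ₗ fgrad ((((L ^ kk : ℕ) : ℝ))⁻¹)⁻¹ (liftEquiv (scShift d L mv kk hL μ) ι)) ∘ₗ mulOp (fun p : ScX d L mv kk hL × ι => scPsi d L mv kk hL k p.1))) ∧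
      (∀ k μ, (mulOp (fun p : ScX d L mv kk hL × ι => scPsi d L mv kk hL k p.1) ∘ₗ ((Matrix.mulVecLin (cGreen (cvM d L mv kk hL) (L ^ kk) (fun (_ : Fin (d + 1)) (_ : ScX d L mv kk hL) => (1 : Matrix ι ι ℝ)) (aK a₀ (L : ℝ) kk * (((L ^ kk : ℕ) : ℝ)) ^ (d + 1)))) ∘ₗ bgrad ((((L ^ kk : ℕ) : ℝ))⁻¹)⁻¹
          (liftEquiv (scShift d L mv kk hL μ) ι)) ∘ₗ mulOp (fun p : ScX d L mv kk hL × ι => scPsi d L mv kk hL k p.1)) ∘ₗ mulOp (fun p : ScX d L mv kk hL × ι => scPsi d L mv kk hL k p.1) = (mulOp (fun p : ScX d L mv kk hL × ι => scPsi d L mv kk hL k p.1) ∘ₗ ((Matrix.mulVecLin (cGreen (cvM d L mv kk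
          hL) (L ^ kk) (fun (_ : Fin (d + 1)) (_ : ScX d L mv kk hL) => (1 : Matrix ι ι ℝ)) (aK a₀ (L : ℝ) kk * (((L ^ kk : ℕ) : ℝ)) ^ (d + 1)))) ∘ₗ bgrad ((((L ^ kk : ℕ) : ℝ))⁻¹)⁻¹ (liftEquiv (scShift d L mv kk hL μ) ι)) ∘ₗ mulOp (fun p : ScX d L mv kk hL × ι => scPsi d L mv kk hL k p.1))) ∧
      (∀ k, (mulOp (fun p : ScX d L mv kk hL × ι => scBump d L mv kk hL k p.1) ∘ₗ (mulOp (fun p : ScX d L mv kk hL × ι => scPsi d L mv kk hL k p.1) ∘ₗ scCube d L mv kk hL (aK a₀ (L : ℝ) kk * (((L ^ kk : ℕ) : ℝ)) ^ (d + 1)) ι k)) ∘ₗ (lapOp ((((L ^ kk : ℕ) : ℝ))⁻¹)⁻¹ (fun μ => liftEquiv (scShift d L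
          mv kk hL μ) ι) 0 + (scQQ d L mv kk hL (aK a₀ (L : ℝ) kk * (((L ^ kk : ℕ) : ℝ)) ^ (d + 1)) ι)) ∘ₗ mulOp (fun p : ScX d L mv kk hL × ι => scH d L mv kk hL k p.1) = mulOp (fun p : ScX d L mv kk hL × ι => scH d L mv kk hL k p.1)) ∧
      (∀ k x, |scH d L mv kk hL k x| ≤ 1) ∧
      (∀ p : ScX d L mv kk hL × ι, ∑ k, (fun p : ScX d L mv kk hL × ι => scH d L mv kk hL k p.1) p ^ 2 = 1) ∧
      (∀ k, mulOp (fun p : ScX d L mv kk hL × ι => scH d L mv kk hL k p.1) ∘ₗ mulOp (fun p : ScX d L mv kk hL × ι => scChi d L mv kk hL k p.1) = mulOp (fun p : ScX d L mv kk hL × ι => scH d L mv kk hL k p.1)) ∧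
      (∀ k μ x, |fgrad ((((L ^ kk : ℕ) : ℝ))⁻¹)⁻¹ (scShift d L mv kk hL μ) (scH d L mv kk hL k) x| ≤ (π / ((L ^ mv : ℕ) : ℝ))) ∧
      (∀ k μ x, |bgrad ((((L ^ kk : ℕ) : ℝ))⁻¹)⁻¹ (scShift d L mv kk hL μ) (scH d L mv kk hL k) x| ≤ (π / ((L ^ mv : ℕ) : ℝ))) ∧
      (∀ k μ x, |scH d L mv kk hL k (scShift d L mv kk hL μ x) - scH d L mv kk hL k x| ≤ (π / ((L ^ mv : ℕ) : ℝ))) ∧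
      (∀ k x, |scH d L mv kk hL k x - coverHb (cvM d L mv kk hL) (L ^ kk) (L ^ mv) L k (scBlk d L mv kk hL x)| ≤ (π * (d + 1) / ((L ^ mv : ℕ) : ℝ))) ∧
      (∀ k μ p, |fgradAdj ((((L ^ kk : ℕ) : ℝ))⁻¹)⁻¹ (liftEquiv (scShift d L mv kk hL μ) ι) (fgrad ((((L ^ kk : ℕ) : ℝ))⁻¹)⁻¹ (liftEquiv (scShift d L mv kk hL μ) ι) (fun p : ScX d L mv kk hL × ι => scH d L mv kk hL k p.1)) p| ≤ (32 * π ^ 2 / ((L ^ mv : ℕ) : ℝ) ^ 2)) ∧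
      (∀ k μ p, |fgrad ((((L ^ kk : ℕ) : ℝ))⁻¹)⁻¹ (liftEquiv (scShift d L mv kk hL μ) ι) (fgrad ((((L ^ kk : ℕ) : ℝ))⁻¹)⁻¹ (liftEquiv (scShift d L mv kk hL μ) ι) (fun p : ScX d L mv kk hL × ι => scH d L mv kk hL k p.1)) p| ≤ (32 * π ^ 2 / ((L ^ mv : ℕ) : ℝ) ^ 2)) ∧
      (∀ k μ p, |bgrad ((((L ^ kk : ℕ) : ℝ))⁻¹)⁻¹ (liftEquiv (scShift d L mv kk hL μ) ι) (bgrad ((((L ^ kk : ℕ) : ℝ))⁻¹)⁻¹ (liftEquiv (scShift d L mv kk hL μ) ι) (fun p : ScX d L mv kk hL × ι => scH d L mv kk hL k p.1) ∘ ⇑(liftEquiv (scShift d L mv kk hL μ) ι)) p| ≤ (32 * π ^ 2 / ((L ^ mv : ℕ) : ℝ)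
          ^ 2)) ∧
      (∀ k μ x, scH d L mv kk hL k x ≠ scH d L mv kk hL k ((scShift d L mv kk hL μ).symm x) → scChi d L mv kk hL k x = 1) ∧
      (∀ k μ x, scH d L mv kk hL k (scShift d L mv kk hL μ x) ≠ scH d L mv kk hL k x → scChi d L mv kk hL k x = 1) ∧
      (∀ k x, scH d L mv kk hL k (scShift d L mv kk hL ν x) ≠ 0 → scChi d L mv kk hL k x = 1) ∧
      (∀ k, mulOp (fun p : ScX d L mv kk hL × ι => scH d L mv kk hL k p.1) ∘ₗ mulOp (fun p : ScX d L mv kk hL × ι => scPsi d L mv kk hL k p.1) = mulOp (fun p : ScX d L mv kk hL × ι => scH d L mv kk hL k p.1)) ∧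
      (∀ k, mulOp (fun p : ScX d L mv kk hL × ι => scBump d L mv kk hL k p.1) ∘ₗ mulOp (fun p : ScX d L mv kk hL × ι => scH d L mv kk hL k p.1) = mulOp (fun p : ScX d L mv kk hL × ι => scH d L mv kk hL k p.1)) ∧
      (∀ k μ, mulOp (fun p : ScX d L mv kk hL × ι => scBump d L mv kk hL k p.1) ∘ₗ mulOp ((fun p : ScX d L mv kk hL × ι => scH d L mv kk hL k p.1) ∘ (liftEquiv (scShift d L mv kk hL μ) ι)) = mulOp ((fun p : ScX d L mv kk hL × ι => scH d L mv kk hL k p.1) ∘ (liftEquiv (scShift d L mv kk hL μ) ι))) ∧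
      (∀ k μ, mulOp (fun p : ScX d L mv kk hL × ι => scBump d L mv kk hL k p.1) ∘ₗ mulOp ((fun p : ScX d L mv kk hL × ι => scH d L mv kk hL k p.1) ∘ (liftEquiv (scShift d L mv kk hL μ) ι).symm) = mulOp ((fun p : ScX d L mv kk hL × ι => scH d L mv kk hL k p.1) ∘ (liftEquiv (scShift d L mv kk hL μ)
          ι).symm)) ∧
      (∀ k μ, mulOp (fun p : ScX d L mv kk hL × ι => scBump d L mv kk hL k p.1) ∘ₗ mulOp (fgrad ((((L ^ kk : ℕ) : ℝ))⁻¹)⁻¹ (liftEquiv (scShift d L mv kk hL μ) ι) (fun p : ScX d L mv kk hL × ι => scH d L mv kk hL k p.1)) = mulOp (fgrad ((((L ^ kk : ℕ) : ℝ))⁻¹)⁻¹ (liftEquiv (scShift d L mv kk hL μ)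
          ι) (fun p : ScX d L mv kk hL × ι => scH d L mv kk hL k p.1))) ∧
      (∀ k μ, mulOp (fun p : ScX d L mv kk hL × ι => scBump d L mv kk hL k p.1) ∘ₗ mulOp (bgrad ((((L ^ kk : ℕ) : ℝ))⁻¹)⁻¹ (liftEquiv (scShift d L mv kk hL μ) ι) (fun p : ScX d L mv kk hL × ι => scH d L mv kk hL k p.1)) = mulOp (bgrad ((((L ^ kk : ℕ) : ℝ))⁻¹)⁻¹ (liftEquiv (scShift d L mv kk hL μ)
          ι) (fun p : ScX d L mv kk hL × ι => scH d L mv kk hL k p.1))) ∧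
      (∀ k, HasMaj (ScNorm d L mv kk hL ι) (ScNorm d L mv kk hL ι) (commOp (scQQ d L mv kk hL (aK a₀ (L : ℝ) kk * (((L ^ kk : ℕ) : ℝ)) ^ (d + 1)) ι) (fun p : ScX d L mv kk hL × ι => scH d L mv kk hL k p.1)) (fun y y' => ((π * (d + 1) / ((L ^ mv : ℕ) : ℝ) * 0 + 2 * (π * (d + 1) / ((L ^ mv : ℕ) :
          ℝ))) * a₀) * Real.exp (-((δm / 2) * (unitTorusGeo L kk (cvM d L mv kk hL)).dist y y')))) := by
  obtain ⟨hL2, hL3⟩ : 2 ≤ L ∧ 3 ≤ L := ⟨by omega, by omega⟩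
  have hL1r : (1 : ℝ) < (L : ℝ) := by exact_mod_cast hL.2
  set cr : ℝ := B4Sect5Proof.latticeConst (d + 1) (δm / 32) with hcr_def
  have hcr0 : 0 ≤ cr := B4Sect5Proof.latticeConst_nonneg (d + 1) (by positivity)
  set δT : ℝ := δm - δm / 32 with hδTdef
  set βQ : ℝ := C * Real.exp δm * cr + C with hβQdef
  have hβQ0 : 0 ≤ βQ := by positivity
  -- the data of the cover at `(m, k)` (as in n15-c∕262)
  have hn : 1 ≤ L ^ kk := Nat.one_le_pow _ _ (by omega)
  have hW2R : (2 : ℝ) ≤ ((L ^ mv : ℕ) : ℝ) := by linarith only [hW4R]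
  have hW2 : 2 ≤ L ^ mv := by exact_mod_cast hW2R
  have hW3 : 3 ≤ L ^ mv := by
    -- `L ≥ 7` is odd-free here: `L^m = 2` is impossible for `L ≥ 7` unless `m = 0`, when `L^0 = 1 < 2`
    rcases Nat.eq_zero_or_pos mv with h0 | hpos
    · subst h0; simp at hW2
    · calc 3 ≤ 7 := by norm_num
        _ ≤ L := hL7
        _ = L ^ 1 := (pow_one L).symm
        _ ≤ L ^ mv := Nat.pow_le_pow_right (by omega) hpos
  have hw : 0 < L ^ mv := by omega
  have hW1 : (1 : ℝ) ≤ ((L ^ mv : ℕ) : ℝ) := by linarith only [hW2R]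
  have hWpos : (0 : ℝ) < ((L ^ mv : ℕ) : ℝ) := by linarith only [hW2R]
  have hM : ∀ ν, cvM d L mv kk hL ν = 2 * L * L ^ mv := MP_succ_eq L mv kk hL
  have hMc : ∀ ν, cvM d L mv kk hL ν = 2 * L ^ (mv + 1) := fun ν => rfl
  have hlo : (2 : ℝ) * ((L ^ mv : ℕ) : ℝ) ≤ ((2 * L ^ mv : ℕ) : ℝ) := by push_cast; exact le_rfl
  have hhi : ((2 * L ^ mv : ℕ) : ℝ) + ((L ^ mv : ℕ) : ℝ) + (2 + 1) * ((L ^ mv : ℕ) : ℝ) + 1 ≤ ((6 * L ^ mv + 1 : ℕ) : ℝ) := by push_cast; linarith only []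
  have hS6 : 6 * L ^ mv + 1 ≤ 2 * L * L ^ mv := by
    have h7 : 7 * L ^ mv ≤ L * L ^ mv := Nat.mul_le_mul_right _ hL7
    have e : 2 * L * L ^ mv = 2 * (L * L ^ mv) := by ring
    rw [e]; omega
  have hm₁ : 2 * L ^ mv ≤ coverMargin L mv := two_mul_le_coverMargin hL7 mv
  have hfitI : coverMargin L mv - 2 * L ^ mv + (6 * L ^ mv + 1) ≤ L * L ^ mv := coverMargin_inner_fit hL7 hW2
  have hm₂ : 2 * L ^ mv + 1 ≤ coverMargin L mv := (coverMargin_cut_margin hL7 hW3).1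
  have hfit₂ : coverMargin L mv - 2 * L ^ mv + (6 * L ^ mv + 1) + 1 ≤ L * L ^ mv := (coverMargin_cut_margin hL7 hW3).2
  have hfit0 := coverMargin_fit hL3 mv
  have hfit : coverMargin L mv + 2 * L ^ mv + 1 ≤ L * L ^ mv := by omega
  have hS0 : L * L ^ mv ≤ 2 * L * L ^ mv := by rw [mul_assoc]; omega
  have hR2 : 1 + |(((L ^ kk : ℕ) : ℝ) * ((L ^ mv : ℕ) : ℝ))⁻¹| ≤ (2 : ℝ) := one_add_inv_le_of_two_le 2 hw le_rfl
  obtain ⟨hK0, hK2⟩ : 0 < 2 * L ∧ 2 ≤ 2 * L := ⟨by omega, by omega⟩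
  set η : ℝ := (((L ^ kk : ℕ) : ℝ))⁻¹ with hη
  set W : ℝ := ((L ^ mv : ℕ) : ℝ) with hWdef
  have hηinv : η⁻¹ = ((L ^ kk : ℕ) : ℝ) := by rw [hη, inv_inv]
  have hnr : (0 : ℝ) < ((L ^ kk : ℕ) : ℝ) := by exact_mod_cast hn
  have hη1 : (1 : ℝ) ≤ η⁻¹ := by rw [hηinv]; exact_mod_cast hn
  have hrowS : RowSum (unitTorusGeo L kk (cvM d L mv kk hL)) (δm / 32) cr := by rw [hcr_def]; exact rowSum_unitTorusGeo L kk _ (by positivity)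
  -- the site coordinates' step and the partition letters
  have hξS := scXi_shift_lift ι hM hw (d := d) (L := L) (mv := mv) (kk := kk) (hL := hL)
  have hξ0 : ∀ μ ν (x : ScX d L mv kk hL), ∃ z : ℤ, scXi d L mv kk hL ν (scShift d L mv kk hL μ x) =
      scXi d L mv kk hL ν x + (if ν = μ then ((((L ^ kk : ℕ) : ℝ)) * ((L ^ mv : ℕ) : ℝ))⁻¹ else 0) + (z : ℝ) * ((2 * L : ℕ) : ℝ) :=
    fun μ ν x => coverXi_shift (n := L ^ kk) (q := L) hM hw μ ν (x, 0)
  have hs0 : (0 : ℝ) ≤ ((((L ^ kk : ℕ) : ℝ)) * ((L ^ mv : ℕ) : ℝ))⁻¹ := by positivity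
  have hs1 : ((((L ^ kk : ℕ) : ℝ)) * ((L ^ mv : ℕ) : ℝ))⁻¹ ≤ 1 := inv_le_one_of_one_le₀ (one_le_mul_of_one_le_of_one_le (by exact_mod_cast hn) hW1)
  have hsW : |((L ^ kk : ℕ) : ℝ)| * (π * |((((L ^ kk : ℕ) : ℝ)) * ((L ^ mv : ℕ) : ℝ))⁻¹|) = π / W := by
    rw [abs_of_pos hnr, abs_of_nonneg hs0, mul_inv, hWdef]; field_simp
  have hsW2 : ((L ^ kk : ℕ) : ℝ) ^ 2 * (32 * π ^ 2 * (((((L ^ kk : ℕ) : ℝ)) * ((L ^ mv : ℕ) : ℝ))⁻¹) ^ 2) = 32 * π ^ 2 / W ^ 2 := by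
    rw [mul_inv, hWdef]; field_simp
  -- King's window and the flat rows at the mass `a_K(a₀, L, k)·n^{d+1}`
  have haK : 0 < aK a₀ (L : ℝ) kk := aK_pos ha₀ hL1r hk
  have haKle : aK a₀ (L : ℝ) kk ≤ a₀ := aK_le ha₀ hL1r hk
  have ha' : 0 < aK a₀ (L : ℝ) kk * (((L ^ kk : ℕ) : ℝ)) ^ (d + 1) := by positivity
  have hcNle : |aK a₀ (L : ℝ) kk * (((L ^ kk : ℕ) : ℝ)) ^ (d + 1)| * ((((L ^ kk : ℕ) : ℝ)) ^ (d + 1))⁻¹ * (2 * (π * (d + 1) / (L ^ mv : ℕ))) ≤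
      (π * (d + 1) / W * 0 + 2 * (π * (d + 1) / W)) * a₀ := by
    rw [abs_of_pos ha', mul_assoc (aK a₀ (L : ℝ) kk), mul_inv_cancel₀ (by positivity), mul_one, mul_zero, zero_add, hWdef, mul_comm]
    exact mul_le_mul_of_nonneg_left haKle (by positivity)
  -- the flat right entries on sites (n15-c∕282b), weakened to the letter `βQ` and the rate `δT = δm − σ`
  have rateT : ∀ (T : Set (Tor (cvM d L mv kk hL))) {c : ℝ}, 0 ≤ c → ∀ y y' : Tor (cvM d L mv kk hL),
      ind (g := unitTorusGeo L kk (cvM d L mv kk hL)) T y * ind (g := unitTorusGeo L kk (cvM d L mv kk hL)) T y' * (c * Real.exp (-(δm * (unitTorusGeo L kk (cvM d L mv kk hL)).dist y y'))) ≤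
        ind (g := unitTorusGeo L kk (cvM d L mv kk hL)) T y * ind (g := unitTorusGeo L kk (cvM d L mv kk hL)) T y' * (c * Real.exp (-(δT * (unitTorusGeo L kk (cvM d L mv kk hL)).dist y y'))) :=
    fun T c hc y y' => mul_le_mul_of_nonneg_left (exp_rate_mono (unitTorusGeo_dist_nonneg L kk _) hc (by rw [hδTdef]; linarith only [hδm0]) y y')
      (mul_nonneg (ind_nonneg _ _) (ind_nonneg _ _))
  have hGAf : ∀ μ, HasMaj (ScNorm d L mv kk hL ι) (ScNorm d L mv kk hL ι) ((Matrix.mulVecLin (cGreen (cvM d L mv kk hL) (L ^ kk) (fun (_ : Fin (d + 1)) (_ : ScX d L mv kk hL) => (1 : Matrix ι ι ℝ)) (aK a₀ (L : ℝ) kk * (((L ^ kk : ℕ) : ℝ)) ^ (d + 1)))) ∘ₗ fgrad (((L ^ kk : ℕ) : ℝ)) (liftEquiv (scShift d L mv kk hL μ) ι))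
      (fun y y' => βQ * Real.exp (-(δT * (unitTorusGeo L kk (cvM d L mv kk hL)).dist y y'))) := fun μ =>
    (hasMaj_mulVecLin_comp_fgrad ι hC.le (by linarith only [hδm0] : δm / 32 ≤ δm) (by positivity) hrowS hGA μ).mono fun y y' => by
      rw [hδTdef]; exact mul_le_mul_of_nonneg_right (by rw [hβQdef]; exact le_add_of_nonneg_right hC.le) (Real.exp_nonneg _)
  have hGAb : ∀ μ, HasMaj (ScNorm d L mv kk hL ι) (ScNorm d L mv kk hL ι) ((Matrix.mulVecLin (cGreen (cvM d L mv kk hL) (L ^ kk) (fun (_ : Fin (d + 1)) (_ : ScX d L mv kk hL) => (1 : Matrix ι ι ℝ)) (aK a₀ (L : ℝ) kk * (((L ^ kk : ℕ) : ℝ)) ^ (d + 1)))) ∘ₗ bgrad (((L ^ kk : ℕ) : ℝ)) (liftEquiv (scShift d L mv kk hL μ) ι))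
      (fun y y' => βQ * Real.exp (-(δT * (unitTorusGeo L kk (cvM d L mv kk hL)).dist y y'))) := fun μ =>
    (hasMaj_mulVecLin_comp_bgrad ι hC.le hGA μ).mono fun y y' =>
      mul_le_mul (by rw [hβQdef]; exact le_add_of_nonneg_left (by positivity))
        (Real.exp_le_exp.mpr (by rw [hδTdef, unitTorusGeo_dist]; nlinarith only [hδm0, tdistT_nonneg (cvM d L mv kk hL) y y'])) (Real.exp_nonneg _) hβQ0
  -- the windows of the cut box about the partition cell, radius 2
  have hwin2 : ∀ (μ : Fin (d + 1)) (k : Fin (d + 1) → ZMod (2 * L)) (p : ScX d L mv kk hL × ι),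
      (∃ p₀ : ScX d L mv kk hL × ι, (p₀ = p ∨ p₀ = (fun μ => liftEquiv (scShift d L mv kk hL μ) ι) μ p ∨ p₀ = ((fun μ => liftEquiv (scShift d L mv kk hL μ) ι) μ).symm p) ∧
        ∀ ν, |cenRep (2 * L) ((fun ν (p : ScX d L mv kk hL × ι) => scXi d L mv kk hL ν p.1) ν p₀ - ((k ν).val : ℝ))| < 2 + 1) →
      (fun p : ScX d L mv kk hL × ι => scChi d L mv kk hL k p.1) p = 1 :=
    fun μ k p hp => scChi_lift_eq_one_of_near_bbox 2 ι hM hw hlo hhi hS6 μ k p hp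
  have hwin : ∀ (μ : Fin (d + 1)) (k : Fin (d + 1) → ZMod (2 * L)) (p : ScX d L mv kk hL × ι),
      (∃ p₀ : ScX d L mv kk hL × ι, (p₀ = p ∨ p₀ = (fun μ => liftEquiv (scShift d L mv kk hL μ) ι) μ p ∨ p₀ = ((fun μ => liftEquiv (scShift d L mv kk hL μ) ι) μ).symm p) ∧
        ∀ ν, |cenRep (2 * L) ((fun ν (p : ScX d L mv kk hL × ι) => scXi d L mv kk hL ν p.1) ν p₀ - ((k ν).val : ℝ))| < 1) →
      (fun p : ScX d L mv kk hL × ι => scChi d L mv kk hL k p.1) p = 1 :=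
    fun μ k => hcubeWindow_of_bumpWindow (2 * L) (fun ν (p : ScX d L mv kk hL × ι) => scXi d L mv kk hL ν p.1) 2
      (fun μ => liftEquiv (scShift d L mv kk hL μ) ι) μ (by norm_num) (hwin2 μ k)
  have hhχ : ∀ (k : Fin (d + 1) → ZMod (2 * L)) (x : ScX d L mv kk hL), scH d L mv kk hL k x ≠ 0 → scChi d L mv kk hL k x ≠ 0 := fun k x hx => by
    have h := chiCube_box_eq_one_of_coverH_ne_zero (n := L ^ kk) hM hw hS6 0 k (x := (x, (0 : Fin (d + 1)))) (Or.inl rfl) hx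
    rw [show scChi d L mv kk hL k x = chiCube (cvM d L mv kk hL) (L ^ kk) (coverCorner (cvM d L mv kk hL) (L ^ mv) L (2 * L ^ mv) k) (6 * L ^ mv + 1) (x, 0) from rfl, h]
    exact one_ne_zero
  -- 281's hypotheses at the cover
  have hSχ : ∀ k x, scChi d L mv kk hL k x ≠ 0 → scBlk d L mv kk hL x ∈ cvSk d L mv kk hL k := fun k x hx => Finset.mem_coe.mpr (blockOf_mem_cubeBlocks_of_inner_ne_zero hM hm₁ hfitI hS0 hx)
  have hSψ : ∀ k x, scPsi d L mv kk hL k x ≠ 0 → scBlk d L mv kk hL x ∈ cvSk d L mv kk hL k := fun k x hx => Finset.mem_coe.mpr (by by_contra h; exact hx (chiCube_of_not_mem h))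
  have hSψ₂ : ∀ k x, scPsi d L mv kk hL k x ≠ 0 → scBlk d L mv kk hL x ∈ cvSk d L mv kk hL k := fun k x hx => Finset.mem_coe.mpr (by by_contra h; exact hx (chiCube_of_not_mem h))
  have hdχt : ∀ k μ p, |fgrad η⁻¹ (liftEquiv (scShift d L mv kk hL μ) ι) (fun p : ScX d L mv kk hL × ι => scBump d L mv kk hL k p.1) p| ≤ (π / W) :=
    by rw [hηinv]; exact fun k μ p => (abs_fgrad_bcube_le (2 * L) (fun ν (p : ScX d L mv kk hL × ι) => scXi d L mv kk hL ν p.1) 2 (fun μ => liftEquiv (scShift d L mv kk hL μ) ι) hK0 hξS _ k μ p).trans hsW.le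
  have hdχtb : ∀ k μ p, |bgrad η⁻¹ (liftEquiv (scShift d L mv kk hL μ) ι) (fun p : ScX d L mv kk hL × ι => scBump d L mv kk hL k p.1) p| ≤ (π / W) :=
    by rw [hηinv]; exact fun k μ p => (abs_bgrad_bcube_le (2 * L) (fun ν (p : ScX d L mv kk hL × ι) => scXi d L mv kk hL ν p.1) 2 (fun μ => liftEquiv (scShift d L mv kk hL μ) ι) hK0 hξS _ k μ p).trans hsW.le
  have hsub : ∀ k, mulOp (fun p : ScX d L mv kk hL × ι => scBump d L mv kk hL k p.1) ∘ₗ mulOp (fun p : ScX d L mv kk hL × ι => scChi d L mv kk hL k p.1) = mulOp (fun p : ScX d L mv kk hL × ι => scBump d L mv kk hL k p.1) :=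
    fun k => bcube_cut (2 * L) (fun ν (p : ScX d L mv kk hL × ι) => scXi d L mv kk hL ν p.1) 2 (fun μ => liftEquiv (scShift d L mv kk hL μ) ι) 0 (hwin2 0 k)
  have hχ : ∀ k, mulOp (fun p : ScX d L mv kk hL × ι => scChi d L mv kk hL k p.1) ∘ₗ mulOp (fun p : ScX d L mv kk hL × ι => scBump d L mv kk hL k p.1) = mulOp (fun p : ScX d L mv kk hL × ι => scBump d L mv kk hL k p.1) :=
    fun k => cut_bcube (2 * L) (fun ν (p : ScX d L mv kk hL × ι) => scXi d L mv kk hL ν p.1) 2 (fun μ => liftEquiv (scShift d L mv kk hL μ) ι) 0 (hwin2 0 k)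
  have hs : ∀ k μ, mulOp ((fun p : ScX d L mv kk hL × ι => scBump d L mv kk hL k p.1) ∘ (liftEquiv (scShift d L mv kk hL μ) ι)) ∘ₗ mulOp (fun p : ScX d L mv kk hL × ι => scChi d L mv kk hL k p.1) = mulOp ((fun p : ScX d L mv kk hL × ι => scBump d L mv kk hL k p.1) ∘ (liftEquiv (scShift d L mv kk hL μ) ι)) :=
    fun k μ => bcube_comp_shift_cut (2 * L) (fun ν (p : ScX d L mv kk hL × ι) => scXi d L mv kk hL ν p.1) 2 (fun μ => liftEquiv (scShift d L mv kk hL μ) ι) μ (hwin2 μ k)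
  have hsb : ∀ k μ, mulOp ((fun p : ScX d L mv kk hL × ι => scBump d L mv kk hL k p.1) ∘ (liftEquiv (scShift d L mv kk hL μ) ι).symm) ∘ₗ mulOp (fun p : ScX d L mv kk hL × ι => scChi d L mv kk hL k p.1) = mulOp ((fun p : ScX d L mv kk hL × ι => scBump d L mv kk hL k p.1) ∘ (liftEquiv (scShift d L mv kk hL μ) ι).symm) :=
    fun k μ => bcube_comp_shift_symm_cut (2 * L) (fun ν (p : ScX d L mv kk hL × ι) => scXi d L mv kk hL ν p.1) 2 (fun μ => liftEquiv (scShift d L mv kk hL μ) ι) μ (hwin2 μ k)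
  have hdd : ∀ k μ, mulOp (fgrad η⁻¹ (liftEquiv (scShift d L mv kk hL μ) ι) (fun p : ScX d L mv kk hL × ι => scBump d L mv kk hL k p.1)) ∘ₗ mulOp (fun p : ScX d L mv kk hL × ι => scChi d L mv kk hL k p.1) = mulOp (fgrad η⁻¹ (liftEquiv (scShift d L mv kk hL μ) ι) (fun p : ScX d L mv kk hL × ι => scBump d L mv kk hL k p.1)) :=
    fun k μ => fgrad_bcube_cut (2 * L) (fun ν (p : ScX d L mv kk hL × ι) => scXi d L mv kk hL ν p.1) 2 (fun μ => liftEquiv (scShift d L mv kk hL μ) ι) μ η⁻¹ (hwin2 μ k)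
  have hddb : ∀ k μ, mulOp (bgrad η⁻¹ (liftEquiv (scShift d L mv kk hL μ) ι) (fun p : ScX d L mv kk hL × ι => scBump d L mv kk hL k p.1)) ∘ₗ mulOp (fun p : ScX d L mv kk hL × ι => scChi d L mv kk hL k p.1) = mulOp (bgrad η⁻¹ (liftEquiv (scShift d L mv kk hL μ) ι) (fun p : ScX d L mv kk hL × ι => scBump d L mv kk hL k p.1)) :=
    fun k μ => bgrad_bcube_cut (2 * L) (fun ν (p : ScX d L mv kk hL × ι) => scXi d L mv kk hL ν p.1) 2 (fun μ => liftEquiv (scShift d L mv kk hL μ) ι) μ η⁻¹ (hwin2 μ k)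
  have hψχ : ∀ k, mulOp (fun p : ScX d L mv kk hL × ι => scPsi d L mv kk hL k p.1) ∘ₗ mulOp (fun p : ScX d L mv kk hL × ι => scChi d L mv kk hL k p.1) = mulOp (fun p : ScX d L mv kk hL × ι => scChi d L mv kk hL k p.1) :=
    fun k => mulOp_comp_mulOp_of_support_left fun p hp => chiCube_eq_one_of_inner_ne_zero hM hm₁ hfitI hS0 hp
  have hcut : ∀ k, HasMaj (ScNorm d L mv kk hL ι) (ScNorm d L mv kk hL ι) (mulOp (fun p : ScX d L mv kk hL × ι => scChi d L mv kk hL k p.1) ∘ₗ (mulOp (fun p : ScX d L mv kk hL × ι => scPsi d L mv kk hL k p.1) ∘ₗ scCube d L mv kk hL (aK a₀ (L : ℝ) kk * (((L ^ kk : ℕ) : ℝ)) ^ (d + 1)) ι k)) (fun y y' => ind (g := (unitTorusGeo L kk (cvM d L mv kk hL))) (cvSk d L mv kk hL k) y * ind (g := (unitTorusGeo L kk (cvM d L mv kk hL))) (cvSk d L mv kk hL k) y' * (C * Real.exp (-(δT * (unitTorusGeo L kk (cvM d L mv kk hL)).dist y y')))) :=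
    fun k => (hasMaj_cut_scCubeP ι hM hm₁ hfitI hm₂ hfit₂ hS0 hC.le hG0 k).mono (rateT _ hC.le)
  have hcutF : ∀ k μ, HasMaj (ScNorm d L mv kk hL ι) (ScNorm d L mv kk hL ι) (mulOp (fun p : ScX d L mv kk hL × ι => scChi d L mv kk hL k p.1) ∘ₗ (fgrad η⁻¹ (liftEquiv (scShift d L mv kk hL μ) ι) ∘ₗ (mulOp (fun p : ScX d L mv kk hL × ι => scPsi d L mv kk hL k p.1) ∘ₗ scCube d L mv kk hL (aK a₀ (L : ℝ) kk * (((L ^ kk : ℕ) : ℝ)) ^ (d + 1)) ι k))) (fun y y' => ind (g := (unitTorusGeo L kk (cvM d L mv kk hL))) (cvSk d L mv kk hL k) y * ind (g := (unitTorusGeo L kk (cvM d L mv kk hL))) (cvSk d L mv kk hL k) y' * (C * Real.exp (-(δT * (unitTorusGeo L kk (cvM d L mv kk hL)).dist y y')))) :=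
    fun k μ => (hasMaj_cutF_scCubeP ι hM hm₁ hfitI hm₂ hfit₂ hS0 hC μ hGF k).mono (rateT _ hC.le)
  have hcutB : ∀ k μ, HasMaj (ScNorm d L mv kk hL ι) (ScNorm d L mv kk hL ι) (mulOp (fun p : ScX d L mv kk hL × ι => scChi d L mv kk hL k p.1) ∘ₗ (bgrad η⁻¹ (liftEquiv (scShift d L mv kk hL μ) ι) ∘ₗ (mulOp (fun p : ScX d L mv kk hL × ι => scPsi d L mv kk hL k p.1) ∘ₗ scCube d L mv kk hL (aK a₀ (L : ℝ) kk * (((L ^ kk : ℕ) : ℝ)) ^ (d + 1)) ι k))) (fun y y' => ind (g := (unitTorusGeo L kk (cvM d L mv kk hL))) (cvSk d L mv kk hL k) y * ind (g := (unitTorusGeo L kk (cvM d L mv kk hL))) (cvSk d L mv kk hL k) y' * (C * Real.exp (-(δT * (unitTorusGeo L kk (cvM d L mv kk hL)).dist y y')))) :=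
    fun k μ => (hasMaj_cutB_scCubeP ι hM hm₁ hfitI hm₂ hfit₂ hS0 hC μ hGB k).mono (rateT _ hC.le)
  have hTf : ∀ k μ, (mulOp (fun p : ScX d L mv kk hL × ι => scPsi d L mv kk hL k p.1) ∘ₗ scCube d L mv kk hL (aK a₀ (L : ℝ) kk * (((L ^ kk : ℕ) : ℝ)) ^ (d + 1)) ι k) ∘ₗ fgrad η⁻¹ (liftEquiv (scShift d L mv kk hL μ) ι) ∘ₗ mulOp (fun p : ScX d L mv kk hL × ι => scChi d L mv kk hL k p.1) = (mulOp (fun p : ScX d L mv kk hL × ι => scPsi d L mv kk hL k p.1) ∘ₗ ((Matrix.mulVecLin (cGreen (cvM d L mv kk hL) (L ^ kk) (fun (_ : Fin (d + 1)) (_ : ScX d L mv kk hL) => (1 : Matrix ι ι ℝ)) (aK a₀ (L : ℝ) kk * (((L ^ kk : ℕ) : ℝ)) ^ (d + 1)))) ∘ₗ fgrad η⁻¹ (liftEquiv (scShift d L mv kk hL μ) ι)) ∘ₗ mulOp (fun p : ScX d L mv kk hL × ι => scPsi d L mv kk hL k p.1)) ∘ₗ mulOp (fun p : ScX d L mv kk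 hL × ι => scChi d L mv kk hL k p.1) :=
    fun k μ => scCubeP_fgrad_sandwich ι hM hm₂ hfit₂ hS0 _ _ μ k
  have hTb : ∀ k μ, (mulOp (fun p : ScX d L mv kk hL × ι => scPsi d L mv kk hL k p.1) ∘ₗ scCube d L mv kk hL (aK a₀ (L : ℝ) kk * (((L ^ kk : ℕ) : ℝ)) ^ (d + 1)) ι k) ∘ₗ bgrad η⁻¹ (liftEquiv (scShift d L mv kk hL μ) ι) ∘ₗ mulOp (fun p : ScX d L mv kk hL × ι => scChi d L mv kk hL k p.1) = (mulOp (fun p : ScX d L mv kk hL × ι => scPsi d L mv kk hL k p.1) ∘ₗ ((Matrix.mulVecLin (cGreen (cvM d L mv kk hL) (L ^ kk) (fun (_ : Fin (d + 1)) (_ : ScX d L mv kk hL) => (1 : Matrix ι ι ℝ)) (aK a₀ (L : ℝ) kk * (((L ^ kk : ℕ) : ℝ)) ^ (d + 1)))) ∘ₗ bgrad η⁻¹ (liftEquiv (scShift d L mv kk hL μ) ι)) ∘ₗ mulOp (fun p : ScX d L mv kk hL × ι => scPsi d L mv kk hL k p.1)) ∘ₗ mulOp (fun p : ScX d L mv kk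 hL × ι => scChi d L mv kk hL k p.1) :=
    fun k μ => scCubeP_bgrad_sandwich ι hM hm₂ hfit₂ hS0 _ _ μ k
  have hTfr : ∀ k μ, HasMaj (ScNorm d L mv kk hL ι) (ScNorm d L mv kk hL ι) ((mulOp (fun p : ScX d L mv kk hL × ι => scPsi d L mv kk hL k p.1) ∘ₗ ((Matrix.mulVecLin (cGreen (cvM d L mv kk hL) (L ^ kk) (fun (_ : Fin (d + 1)) (_ : ScX d L mv kk hL) => (1 : Matrix ι ι ℝ)) (aK a₀ (L : ℝ) kk * (((L ^ kk : ℕ) : ℝ)) ^ (d + 1)))) ∘ₗ fgrad η⁻¹ (liftEquiv (scShift d L mv kk hL μ) ι)) ∘ₗ mulOp (fun p : ScX d L mv kk hL × ι => scPsi d L mv kk hL k p.1))) (fun y y' => ind (g := (unitTorusGeo L kk (cvM d L mv kk hL))) (cvSk d L mv kk hL k) y * ind (g := (unitTorusGeo L kk (cvM d L mv kk hL))) (cvSk d L mv kk hL k) y' * (βQ * Real.exp (-(δT * (unitTorusGeo L kk (cvM d L mv kk hL)).dist y y')))) :=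
    fun k μ => by rw [hηinv]; exact hasMaj_scT ι hβQ0 (hGAf μ) k
  have hTbr : ∀ k μ, HasMaj (ScNorm d L mv kk hL ι) (ScNorm d L mv kk hL ι) ((mulOp (fun p : ScX d L mv kk hL × ι => scPsi d L mv kk hL k p.1) ∘ₗ ((Matrix.mulVecLin (cGreen (cvM d L mv kk hL) (L ^ kk) (fun (_ : Fin (d + 1)) (_ : ScX d L mv kk hL) => (1 : Matrix ι ι ℝ)) (aK a₀ (L : ℝ) kk * (((L ^ kk : ℕ) : ℝ)) ^ (d + 1)))) ∘ₗ bgrad η⁻¹ (liftEquiv (scShift d L mv kk hL μ) ι)) ∘ₗ mulOp (fun p : ScX d L mv kk hL × ι => scPsi d L mv kk hL k p.1))) (fun y y' => ind (g := (unitTorusGeo L kk (cvM d L mv kk hL))) (cvSk d L mv kk hL k) y * ind (g := (unitTorusGeo L kk (cvM d L mv kk hL))) (cvSk d L mv kk hL k) y' * (βQ * Real.exp (-(δT * (unitTorusGeo L kk (cvM d L mv kk hL)).dist y y')))) :=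
    fun k μ => by rw [hηinv]; exact hasMaj_scT ι hβQ0 (hGAb μ) k
  have hflat0 : ∀ k, (mulOp (fun p : ScX d L mv kk hL × ι => scBump d L mv kk hL k p.1) ∘ₗ (mulOp (fun p : ScX d L mv kk hL × ι => scPsi d L mv kk hL k p.1) ∘ₗ scCube d L mv kk hL (aK a₀ (L : ℝ) kk * (((L ^ kk : ℕ) : ℝ)) ^ (d + 1)) ι k)) ∘ₗ (lapOp η⁻¹ (fun μ => liftEquiv (scShift d L mv kk hL μ) ι) 0 + (scQQ d L mv kk hL (aK a₀ (L : ℝ) kk * (((L ^ kk : ℕ) : ℝ)) ^ (d + 1)) ι)) ∘ₗ mulOp (fun p : ScX d L mv kk hL × ι => scH d L mv kk hL k p.1) = mulOp (fun p : ScX d L mv kk hL × ι => scH d L mv kk hL k p.1) :=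
    fun k => by rw [hηinv]; exact scCubeP_flat_rightLocality ι hM hm₂ hfit₂ hS0 hw hfit ha' k (hhχ k)
  have hhcut : ∀ k, mulOp (fun p : ScX d L mv kk hL × ι => scH d L mv kk hL k p.1) ∘ₗ mulOp (fun p : ScX d L mv kk hL × ι => scChi d L mv kk hL k p.1) = mulOp (fun p : ScX d L mv kk hL × ι => scH d L mv kk hL k p.1) :=
    fun k => hcube_cut (2 * L) (fun ν (p : ScX d L mv kk hL × ι) => scXi d L mv kk hL ν p.1) (fun μ => liftEquiv (scShift d L mv kk hL μ) ι) 0 (hwin 0 k)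
  have hh1 : ∀ k μ x, |fgrad η⁻¹ (scShift d L mv kk hL μ) (scH d L mv kk hL k) x| ≤ (π / W) :=
    by rw [hηinv]; exact fun k μ x => (abs_fgrad_hcube_le (2 * L) (scXi d L mv kk hL) (scShift d L mv kk hL) hK0 hξ0 _ k μ x).trans hsW.le
  have hh1b : ∀ k μ x, |bgrad η⁻¹ (scShift d L mv kk hL μ) (scH d L mv kk hL k) x| ≤ (π / W) :=
    by rw [hηinv]; exact fun k μ x => (abs_bgrad_hcube_le (2 * L) (scXi d L mv kk hL) (scShift d L mv kk hL) hK0 hξ0 _ k μ x).trans hsW.le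
  have hh0 : ∀ k μ x, |scH d L mv kk hL k (scShift d L mv kk hL μ x) - scH d L mv kk hL k x| ≤ (π / W) := fun k μ x => abs_shift_sub_le_of_fgrad _ _ hη1 (hh1 k μ) x
  have hh2 : ∀ k μ p, |fgradAdj η⁻¹ (liftEquiv (scShift d L mv kk hL μ) ι) (fgrad η⁻¹ (liftEquiv (scShift d L mv kk hL μ) ι) (fun p : ScX d L mv kk hL × ι => scH d L mv kk hL k p.1)) p| ≤ (32 * π ^ 2 / W ^ 2) :=
    by rw [hηinv]; exact fun k μ p => (abs_fgradAdj_fgrad_hcube_le (2 * L) (fun ν (p : ScX d L mv kk hL × ι) => scXi d L mv kk hL ν p.1) (fun μ => liftEquiv (scShift d L mv kk hL μ) ι) hK2 hξS hs0 hs1 _ k μ p).trans hsW2.le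
  have hh2f : ∀ k μ p, |fgrad η⁻¹ (liftEquiv (scShift d L mv kk hL μ) ι) (fgrad η⁻¹ (liftEquiv (scShift d L mv kk hL μ) ι) (fun p : ScX d L mv kk hL × ι => scH d L mv kk hL k p.1)) p| ≤ (32 * π ^ 2 / W ^ 2) :=
    fun k μ p => abs_fgrad_fgrad_le_of _ _ (hh2 k μ) p
  have hh2b : ∀ k μ p, |bgrad η⁻¹ (liftEquiv (scShift d L mv kk hL μ) ι) (bgrad η⁻¹ (liftEquiv (scShift d L mv kk hL μ) ι) (fun p : ScX d L mv kk hL × ι => scH d L mv kk hL k p.1) ∘ ⇑(liftEquiv (scShift d L mv kk hL μ) ι)) p| ≤ (32 * π ^ 2 / W ^ 2) :=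
    fun k μ p => abs_bgrad_bgrad_shift_le_of _ _ (hh2 k μ) p
  have hlayf : ∀ k μ x, scH d L mv kk hL k x ≠ scH d L mv kk hL k ((scShift d L mv kk hL μ).symm x) → scChi d L mv kk hL k x = 1 :=
    fun k μ x h => coverH_layer_bwd hM hw hS6 k μ (x, 0) (by rwa [← scShift_symm_apply])
  have hlayb : ∀ k μ x, scH d L mv kk hL k (scShift d L mv kk hL μ x) ≠ scH d L mv kk hL k x → scChi d L mv kk hL k x = 1 := fun k μ x h => coverH_layer_fwd hM hw hS6 k μ (x, 0) h
  have hlayν : ∀ k x, scH d L mv kk hL k (scShift d L mv kk hL ν x) ≠ 0 → scChi d L mv kk hL k x = 1 := fun k x h => coverH_layer_shift hM hw hS6 k ν (x, 0) h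
  have hhψ : ∀ k, mulOp (fun p : ScX d L mv kk hL × ι => scH d L mv kk hL k p.1) ∘ₗ mulOp (fun p : ScX d L mv kk hL × ι => scPsi d L mv kk hL k p.1) = mulOp (fun p : ScX d L mv kk hL × ι => scH d L mv kk hL k p.1) :=
    fun k => mulOp_scH_comp_mulOp_scPsi ι hM hw hfit k
  have hχth : ∀ k, mulOp (fun p : ScX d L mv kk hL × ι => scBump d L mv kk hL k p.1) ∘ₗ mulOp (fun p : ScX d L mv kk hL × ι => scH d L mv kk hL k p.1) = mulOp (fun p : ScX d L mv kk hL × ι => scH d L mv kk hL k p.1) :=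
    fun k => mulOp_comp_mulOp_of_support_left fun p hp => bcube_eq_one_of_hcube_ne_zero_self (2 * L) (fun ν (p : ScX d L mv kk hL × ι) => scXi d L mv kk hL ν p.1) 2 (by norm_num) hp
  have hhts' : ∀ k μ, mulOp (fun p : ScX d L mv kk hL × ι => scBump d L mv kk hL k p.1) ∘ₗ mulOp ((fun p : ScX d L mv kk hL × ι => scH d L mv kk hL k p.1) ∘ (liftEquiv (scShift d L mv kk hL μ) ι)) = mulOp ((fun p : ScX d L mv kk hL × ι => scH d L mv kk hL k p.1) ∘ (liftEquiv (scShift d L mv kk hL μ) ι)) :=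
    fun k μ => mulOp_comp_mulOp_of_support_left fun p hp => bcube_eq_one_of_hcube_ne_zero (2 * L) (fun ν (p : ScX d L mv kk hL × ι) => scXi d L mv kk hL ν p.1) 2 (fun μ => liftEquiv (scShift d L mv kk hL μ) ι) hK0 hξS hR2 μ (x := (fun μ => liftEquiv (scShift d L mv kk hL μ) ι) μ p) (Or.inr (Or.inr (by simp))) hp
  have hhtsb' : ∀ k μ, mulOp (fun p : ScX d L mv kk hL × ι => scBump d L mv kk hL k p.1) ∘ₗ mulOp ((fun p : ScX d L mv kk hL × ι => scH d L mv kk hL k p.1) ∘ (liftEquiv (scShift d L mv kk hL μ) ι).symm) = mulOp ((fun p : ScX d L mv kk hL × ι => scH d L mv kk hL k p.1) ∘ (liftEquiv (scShift d L mv kk hL μ) ι).symm) :=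
    fun k μ => mulOp_comp_mulOp_of_support_left fun p hp => bcube_eq_one_of_hcube_ne_zero (2 * L) (fun ν (p : ScX d L mv kk hL × ι) => scXi d L mv kk hL ν p.1) 2 (fun μ => liftEquiv (scShift d L mv kk hL μ) ι) hK0 hξS hR2 μ (x := ((fun μ => liftEquiv (scShift d L mv kk hL μ) ι) μ).symm p) (Or.inr (Or.inl (by simp))) hp
  have hhtdd' : ∀ k μ, mulOp (fun p : ScX d L mv kk hL × ι => scBump d L mv kk hL k p.1) ∘ₗ mulOp (fgrad η⁻¹ (liftEquiv (scShift d L mv kk hL μ) ι) (fun p : ScX d L mv kk hL × ι => scH d L mv kk hL k p.1)) = mulOp (fgrad η⁻¹ (liftEquiv (scShift d L mv kk hL μ) ι) (fun p : ScX d L mv kk hL × ι => scH d L mv kk hL k p.1)) := fun k μ => mulOp_comp_mulOp_of_support_left fun p hp => by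
    by_cases h0 : scH d L mv kk hL k p.1 = 0
    · have h1 : scH d L mv kk hL k ((liftEquiv (scShift d L mv kk hL μ) ι) p).1 ≠ 0 := by
        intro h1; apply hp; rw [fgrad_apply]; simp only [h0, h1, sub_zero, mul_zero]
      exact bcube_eq_one_of_hcube_ne_zero (2 * L) (fun ν (p : ScX d L mv kk hL × ι) => scXi d L mv kk hL ν p.1) 2 (fun μ => liftEquiv (scShift d L mv kk hL μ) ι) hK0 hξS hR2 μ (x := (fun μ => liftEquiv (scShift d L mv kk hL μ) ι) μ p) (Or.inr (Or.inr (by simp))) h1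
    · exact bcube_eq_one_of_hcube_ne_zero_self (2 * L) (fun ν (p : ScX d L mv kk hL × ι) => scXi d L mv kk hL ν p.1) 2 (by norm_num) h0
  have hhtddb' : ∀ k μ, mulOp (fun p : ScX d L mv kk hL × ι => scBump d L mv kk hL k p.1) ∘ₗ mulOp (bgrad η⁻¹ (liftEquiv (scShift d L mv kk hL μ) ι) (fun p : ScX d L mv kk hL × ι => scH d L mv kk hL k p.1)) = mulOp (bgrad η⁻¹ (liftEquiv (scShift d L mv kk hL μ) ι) (fun p : ScX d L mv kk hL × ι => scH d L mv kk hL k p.1)) := fun k μ => mulOp_comp_mulOp_of_support_left fun p hp => by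
    by_cases h0 : scH d L mv kk hL k p.1 = 0
    · have h1 : scH d L mv kk hL k ((liftEquiv (scShift d L mv kk hL μ) ι).symm p).1 ≠ 0 := by
        intro h1; apply hp; rw [bgrad_apply]; simp only [h0, h1, sub_zero, mul_zero]
      exact bcube_eq_one_of_hcube_ne_zero (2 * L) (fun ν (p : ScX d L mv kk hL × ι) => scXi d L mv kk hL ν p.1) 2 (fun μ => liftEquiv (scShift d L mv kk hL μ) ι) hK0 hξS hR2 μ (x := ((fun μ => liftEquiv (scShift d L mv kk hL μ) ι) μ).symm p) (Or.inr (Or.inl (by simp))) h1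
    · exact bcube_eq_one_of_hcube_ne_zero_self (2 * L) (fun ν (p : ScX d L mv kk hL × ι) => scXi d L mv kk hL ν p.1) 2 (by norm_num) h0
  have hKN : ∀ k, HasMaj (ScNorm d L mv kk hL ι) (ScNorm d L mv kk hL ι) (commOp (scQQ d L mv kk hL (aK a₀ (L : ℝ) kk * (((L ^ kk : ℕ) : ℝ)) ^ (d + 1)) ι) (fun p : ScX d L mv kk hL × ι => scH d L mv kk hL k p.1)) (fun y y' => ((π * (d + 1) / W * 0 + 2 * (π * (d + 1) / W)) * a₀) * Real.exp (-((δm / 2) * (unitTorusGeo L kk (cvM d L mv kk hL)).dist y y'))) :=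
    fun k => (hasMaj_commOp_scQQ ι hM hw _ (δm / 2) k).mono fun y y' => mul_le_mul_of_nonneg_right hcNle (Real.exp_nonneg _)
  exact ⟨hSχ, hSψ, fun k x => abs_bcube_le_one (2 * L) (scXi d L mv kk hL) 2 k x, fun k x => abs_chiCube_le_one _ _, hdχt, hdχtb, hsub, hχ, hs, hsb, hdd, hddb, fun k => scCubeP_comp_mulOp_scPsi ι _ k, hψχ, hcut, hcutF, hcutB, hTf, hTb, hTfr, hTbr, fun k μ => scT_comp_mulOp_scPsi ι _ k, fun k μ => scT_comp_mulOp_scPsi ι _ k, hflat0, fun k x => abs_hcube_le_one (2 * L) (scXi d L mv kk hL) k x, fun p => sum_hcube_sq (2 * L) (scXi d L mv kk hL) hK2 p.1, hhcut, hh1, hh1b, hh0, fun k x => abs_coverH_sub_coverHb_le hM hw k (x, 0), hh2, hh2f, hh2b, hlayf, hlayb, hlayν, hhψ, hχth, hhts', hhtsb', hhtdd', hhtddb', hKN⟩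

end Kit

end Summit.QuantumFields.YangMills.BalabanUVNodes.N15.Gluing

end
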